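import Summits.KontsevichZagierPeriods.KontsevichZagierPeriods.Theses.SymplecticScissors
import Summits.KontsevichZagierPeriods.KontsevichZagierPeriods.Theorems.SymplecticScissorsPlanarAreasStubMixedPartials
import Literature.NumberTheory.Transcendental.KZLogCalculusProofs
import Literature.NumberTheory.Transcendental.SemialgebraicLineDeriv

/-!
# Signed sweep of the triangle, helper I: the smooth locus and Clairaut

Helper file for the stub `stub_signedSweep` of the line `twist-restoring-shear` (crux
`PlanarCompiler`, route `SymplecticScissors`). For a Green datum `(A, B, S)` on the standard
triangle (`A, B` `ℚ`-semialgebraic on the closed triangle `Δ`, `dS = A da + B db` on the open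
triangle `T`) we record:

* the two triangles are `ℚ`-semialgebraic;
* the smooth locus: an open `ℚ`-semialgebraic `W ⊆ T` with `T ∖ W` null and `ℚ`-semialgebraic on
  which `A, B` are `C¹`, Clairaut `∂_b A = ∂_a B` holds (symmetry of the second derivative of
  the potential, `PlanarAreas.fderiv_apply_single_eq_of_potential`), and `∂_b A` is a
  `ℚ`-semialgebraic function (`KZ.exists_isOpen_contDiffOn`,
  `IsSemialgebraicFunOn.fderiv_apply_single`).
-/

noncomputable section

open MeasureTheory Set Filter Topology MvPolynomial
open Literature.NumberTheory.Transcendental Literature.ModelTheory.ExponentialFields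

namespace Summit.KontsevichZagierPeriods.SymplecticScissors.PlanarCompilerProof

/-- The closed and the open standard triangles are `ℚ`-semialgebraic (one conjunction; the
closed-triangle statement alone is already in `Theorems/CurvePeriodsTransfer/Negative/`, a module
that is not built on the farm, hence not importable here). [folklore] -/
theorem isSemialgebraic_triangles :
    IsSemialgebraic ℚ {p : Fin 2 → ℝ | 0 ≤ p 0 ∧ 0 ≤ p 1 ∧ p 0 + p 1 ≤ 1} ∧
      IsSemialgebraic ℚ {p : Fin 2 → ℝ | 0 < p 0 ∧ 0 < p 1 ∧ p 0 + p 1 < 1} := by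
  -- adapted from `isSemialgebraic_triangle` in Cruxes/PlanarCompiler/Disproof.lean
  constructor
  · have h := ((isSemialgebraic_setOf_eval_le (k := ℚ) (R := ℝ) (ι := Fin 2) (C 0) (X 0)).inter
      (isSemialgebraic_setOf_eval_le (k := ℚ) (R := ℝ) (ι := Fin 2) (C 0) (X 1))).inter
      (isSemialgebraic_setOf_eval_le (k := ℚ) (R := ℝ) (ι := Fin 2) (X 0 + X 1) (C 1))
    have hEq : {p : Fin 2 → ℝ | 0 ≤ p 0 ∧ 0 ≤ p 1 ∧ p 0 + p 1 ≤ 1} =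
        ({x : Fin 2 → ℝ | aeval x (C 0 : MvPolynomial (Fin 2) ℚ) ≤ aeval x (X 0 : MvPolynomial (Fin 2) ℚ)} ∩
          {x : Fin 2 → ℝ | aeval x (C 0 : MvPolynomial (Fin 2) ℚ) ≤ aeval x (X 1 : MvPolynomial (Fin 2) ℚ)}) ∩
        {x : Fin 2 → ℝ | aeval x (X 0 + X 1 : MvPolynomial (Fin 2) ℚ) ≤ aeval x (C 1 : MvPolynomial (Fin 2) ℚ)} := by
      ext p; simp [and_assoc]
    rw [hEq]; exact h
  · have h := ((isSemialgebraic_setOf_eval_lt (k := ℚ) (R := ℝ) (ι := Fin 2) (C 0) (X 0)).inter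
      (isSemialgebraic_setOf_eval_lt (k := ℚ) (R := ℝ) (ι := Fin 2) (C 0) (X 1))).inter
      (isSemialgebraic_setOf_eval_lt (k := ℚ) (R := ℝ) (ι := Fin 2) (X 0 + X 1) (C 1))
    have hEq : {p : Fin 2 → ℝ | 0 < p 0 ∧ 0 < p 1 ∧ p 0 + p 1 < 1} =
        ({x : Fin 2 → ℝ | aeval x (C 0 : MvPolynomial (Fin 2) ℚ) < aeval x (X 0 : MvPolynomial (Fin 2) ℚ)} ∩
          {x : Fin 2 → ℝ | aeval x (C 0 : MvPolynomial (Fin 2) ℚ) < aeval x (X 1 : MvPolynomial (Fin 2) ℚ)}) ∩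
        {x : Fin 2 → ℝ | aeval x (X 0 + X 1 : MvPolynomial (Fin 2) ℚ) < aeval x (C 1 : MvPolynomial (Fin 2) ℚ)} := by
      ext p; simp [and_assoc]
    rw [hEq]; exact h

/-- The open triangle lies in the closed one. [folklore] -/
theorem openTriangle_subset_closedTriangle :
    {p : Fin 2 → ℝ | 0 < p 0 ∧ 0 < p 1 ∧ p 0 + p 1 < 1} ⊆
      {p : Fin 2 → ℝ | 0 ≤ p 0 ∧ 0 ≤ p 1 ∧ p 0 + p 1 ≤ 1} :=
  fun _ hp => ⟨hp.1.le, hp.2.1.le, hp.2.2.le⟩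

/-- **The smooth locus of a Green datum.** For `A, B` `ℚ`-semialgebraic on the closed triangle and a
potential `S` with `dS = A da + B db` on the open triangle `T`, there is an open `ℚ`-semialgebraic
`W ⊆ T` with `T ∖ W` `ℚ`-semialgebraic and null, on which `A, B` are `C¹` and `ℚ`-semialgebraic,
`∂_b A = ∂_a B`, and `∂_b A` is `ℚ`-semialgebraic. [folklore] -/
theorem stub_signedSweep_smoothLocus :
    ∀ (A B S : (Fin 2 → ℝ) → ℝ),
    IsSemialgebraicFunOn ℚ {p : Fin 2 → ℝ | 0 ≤ p 0 ∧ 0 ≤ p 1 ∧ p 0 + p 1 ≤ 1} A →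
    IsSemialgebraicFunOn ℚ {p : Fin 2 → ℝ | 0 ≤ p 0 ∧ 0 ≤ p 1 ∧ p 0 + p 1 ≤ 1} B →
    (∀ p : Fin 2 → ℝ, 0 < p 0 → 0 < p 1 → p 0 + p 1 < 1 → HasFDerivAt S
      (A p • (ContinuousLinearMap.proj 0 : (Fin 2 → ℝ) →L[ℝ] ℝ) +
        B p • (ContinuousLinearMap.proj 1 : (Fin 2 → ℝ) →L[ℝ] ℝ)) p) →
    ∃ W : Set (Fin 2 → ℝ), IsOpen W ∧ IsSemialgebraic ℚ W ∧
      W ⊆ {p : Fin 2 → ℝ | 0 < p 0 ∧ 0 < p 1 ∧ p 0 + p 1 < 1} ∧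
      IsSemialgebraic ℚ ({p : Fin 2 → ℝ | 0 < p 0 ∧ 0 < p 1 ∧ p 0 + p 1 < 1} \ W) ∧
      volume ({p : Fin 2 → ℝ | 0 < p 0 ∧ 0 < p 1 ∧ p 0 + p 1 < 1} \ W) = 0 ∧
      ContDiffOn ℝ 1 A W ∧ ContDiffOn ℝ 1 B W ∧
      (∀ p ∈ W, fderiv ℝ A p (Pi.single 1 1) = fderiv ℝ B p (Pi.single 0 1)) ∧
      IsSemialgebraicFunOn ℚ W A ∧ IsSemialgebraicFunOn ℚ W B ∧
      IsSemialgebraicFunOn ℚ W (fun p => fderiv ℝ A p (Pi.single 1 1)) := by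
  intro A B S hA hB hS
  set T : Set (Fin 2 → ℝ) := {p : Fin 2 → ℝ | 0 < p 0 ∧ 0 < p 1 ∧ p 0 + p 1 < 1} with hT
  have hTsa : IsSemialgebraic ℚ T := isSemialgebraic_triangles.2
  have hAT : IsSemialgebraicFunOn ℚ T A := hA.mono openTriangle_subset_closedTriangle hTsa
  have hBT : IsSemialgebraicFunOn ℚ T B := hB.mono openTriangle_subset_closedTriangle hTsa
  obtain ⟨GA, hGAT, hGAo, hGAsa, hGAsm, -, hGAnull⟩ := KZ.exists_isOpen_contDiffOn hTsa hAT
  obtain ⟨GB, hGBT, hGBo, hGBsa, hGBsm, -, hGBnull⟩ := KZ.exists_isOpen_contDiffOn hTsa hBT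
  have hWo : IsOpen (GA ∩ GB) := hGAo.inter hGBo
  have hWsa : IsSemialgebraic ℚ (GA ∩ GB) := hGAsa.inter hGBsa
  have hWT : GA ∩ GB ⊆ T := fun p hp => hGAT hp.1
  have hA1 : ContDiffOn ℝ 1 A (GA ∩ GB) := (hGAsm.of_le (by exact_mod_cast le_top)).mono inter_subset_left
  have hB1 : ContDiffOn ℝ 1 B (GA ∩ GB) := (hGBsm.of_le (by exact_mod_cast le_top)).mono inter_subset_right
  have hAW : IsSemialgebraicFunOn ℚ (GA ∩ GB) A := hAT.mono hWT hWsa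
  have hBW : IsSemialgebraicFunOn ℚ (GA ∩ GB) B := hBT.mono hWT hWsa
  refine ⟨GA ∩ GB, hWo, hWsa, hWT, hTsa.diff hWsa, ?_, hA1, hB1, ?_, hAW, hBW, ?_⟩
  · have hsub : T \ (GA ∩ GB) ⊆ (T \ GA) ∪ (T \ GB) := by
      intro p hp
      by_cases h : p ∈ GA
      · exact Or.inr ⟨hp.1, fun h' => hp.2 ⟨h, h'⟩⟩
      · exact Or.inl ⟨hp.1, h⟩
    exact measure_mono_null hsub (measure_union_null hGAnull hGBnull)
  · -- Clairaut on the smooth locus (symmetry of the second derivative of the potential)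
    intro p hp
    refine PlanarAreas.fderiv_apply_single_eq_of_potential (S := S) ?_
      ((hA1.differentiableOn one_ne_zero).differentiableAt (hWo.mem_nhds hp))
      ((hB1.differentiableOn one_ne_zero).differentiableAt (hWo.mem_nhds hp))
    exact Filter.eventually_of_mem (hWo.mem_nhds hp) fun q hq => hS q (hWT hq).1 (hWT hq).2.1 (hWT hq).2.2
  · exact hAW.fderiv_apply_single hWo (fun p hp =>
      (hA1.differentiableOn one_ne_zero).differentiableAt (hWo.mem_nhds hp)) 1

end Summit.KontsevichZagierPeriods.SymplecticScissors.PlanarCompilerProof
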